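import Summits.CriticalPhenomena.PercolationContinuityZ3.Theorems.PercNearOneGluingNoHeavyLowerTailSuperTerminalP3LamDvec
import HarnessLib

/-!
# The port–terminal pairs `cs`, `ca`, `cb` are irrelevant to every row `P3_λ`, `λ ≥ 4/3`

Support file for crux `stmt-CriticalPhenomena-4575` (`NoHeavyLowerTail`), seat `prim-l12-p1` gen 33 (`--supports stmt-CriticalPhenomena-4575`);
companion of `…SuperTerminalP3LamPortPieces` / `…SuperTerminalP3LamPortPart` (pieces not adjacent to the port and the pairs inside `{s,a,b}`
are irrelevant for `λ ≥ 3/2`).  No definitions, no sorries, standard axioms.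

Bond percolation `μ = prodBernoulli w` on a finite vertex type `V`, pairwise distinct `s a b c`; `F = {s↔a} ∩ {s↮b}`, `T = {s,a,b}`; the row
`P3_λ` is `μ(F)·μ(c ↔ T) ≤ λ·μ(F ∩ c ↔ T)` (`λ = 2`: the face row `P3½` of `V4`; conjectured sharp constant `λ = 3/2`).

MAIN THEOREMS (`p3lam_of_csPair_zero`, `p3lam_of_caPair_zero`, `p3lam_of_cbPair_zero`).  **For every `λ ≥ 4/3`: if `P3_λ` holds for `w` with the
pair `cs` (resp. `ca`, `cb`) set to `0`, then it holds for `w`.**  Together with `SuperTerminalP3LamPortPart.p3lam_of_sabPairs_zero` (the pairs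
inside `{s,a,b}`, `λ ≥ 3/2`) the whole terminal piece is irrelevant to the sharp row `P3_{3/2}` — the cell-level `∥`-stability of THEOREM C′
(`SuperTerminalP3LamGluing.p3lam_of_pieces`) gives this only for `λ ≥ 8/5`.

PROOF.  Along the pencil of the pair `e = ct` (weight `r`, `ρ = 1 − r`) the down-set vector is `D_k(w) = ρ·D_k(w[e↦0])` for the down-sets
separating `c` from `t` and `D_k(w) = D_k(w[e↦0])` for the others (`real_partLE_update_cross`, `SuperTerminalDownsets.real_partLE_eq_update_zero`),
and in the cells `σ = μ(F ∩ c∤T)`, `N`, `M = μ(F) − N` of `d = D(w[e↦0])` the row of the composite is the EXACT identity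
`G(ρ) = ρ²·R + (1−ρ)²·(λ−1)N + ρ(1−ρ)·S₂`, `R = λ(μF − σ) − μF(1 − d7) ≥ 0` (the row of `w[e↦0]`), `S₂ = R + (λ−1)N − M·d7`, and
`(λ−1+d7)·S₂ = (λ−1)R + (N − σ)(λ−1+d7)² + σ·[(d7 + (λ−2)/2)² + λ(3λ−4)/4] ≥ 0` for `λ ≥ 4/3` (`N ≥ σ` is an order relation of every
partition law).  No face inequality is needed.
-/

namespace Summit.CriticalPhenomena.PercolationContinuityZ3.Theorems.SuperTerminalP3LamPortTermPairs

open MeasureTheory Set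
open Literature.Probability.Percolation Literature.Probability.Percolation.PartitionGluing
open Literature.Probability.LatticeModels (prodBernoulli)
open SuperTerminalDownsets SuperTerminalDownsetEvents SuperTerminalP3LamDvec
open scoped Classical

variable {V : Type*} [Fintype V]

/-! ## Cell algebra: one port–terminal pair -/

/-- **The pencil lemma** behind all three pairs.  With `μF = M + N`, if `0 ≤ σ ≤ N`, `0 ≤ d7`, `λ ≥ 4/3`, `0 ≤ ρ ≤ 1` and the row
`μF·(1 − d7) ≤ λ·(μF − σ)` holds, then `(ρM + N)(1 − ρ d7) ≤ λ(ρM + N − ρσ)`.  Identity: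
`λ(ρM+N−ρσ) − (ρM+N)(1−ρd7) = ρ²R + (1−ρ)²(λ−1)N + ρ(1−ρ)S₂` with `(λ−1+d7)S₂ = (λ−1)R + (N−σ)(λ−1+d7)² + σ[(d7+(λ−2)/2)² + λ(3λ−4)/4]`. [this work] -/
theorem pencil_row {lam M N σ d7 ρ : ℝ} (hlam : 4 / 3 ≤ lam) (hσ : 0 ≤ σ) (hσN : σ ≤ N) (h7 : 0 ≤ d7) (hρ0 : 0 ≤ ρ) (hρ1 : ρ ≤ 1)
    (hrow : (M + N) * (1 - d7) ≤ lam * (M + N - σ)) :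
    (ρ * M + N) * (1 - ρ * d7) ≤ lam * (ρ * M + N - ρ * σ) := by
  have hA : 0 < lam - 1 + d7 := by linarith
  have hR : 0 ≤ lam * (M + N - σ) - (M + N) * (1 - d7) := by linarith
  have hq : 0 ≤ (d7 + (lam - 2) / 2) ^ 2 + lam * (3 * lam - 4) / 4 := by
    have : 0 ≤ lam * (3 * lam - 4) := mul_nonneg (by linarith) (by linarith)
    nlinarith [sq_nonneg (d7 + (lam - 2) / 2)]
  -- `S₂ ≥ 0`
  have hAS : 0 ≤ (lam - 1 + d7) * ((lam * (M + N - σ) - (M + N) * (1 - d7)) + (lam - 1) * N - M * d7) := by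
    have e : (lam - 1 + d7) * ((lam * (M + N - σ) - (M + N) * (1 - d7)) + (lam - 1) * N - M * d7) =
        (lam - 1) * (lam * (M + N - σ) - (M + N) * (1 - d7)) + (N - σ) * (lam - 1 + d7) ^ 2 +
          σ * ((d7 + (lam - 2) / 2) ^ 2 + lam * (3 * lam - 4) / 4) := by ring
    rw [e]
    have t1 : 0 ≤ (lam - 1) * (lam * (M + N - σ) - (M + N) * (1 - d7)) := mul_nonneg (by linarith) hR
    have t2 : 0 ≤ (N - σ) * (lam - 1 + d7) ^ 2 := mul_nonneg (by linarith) (sq_nonneg _)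
    have t3 : 0 ≤ σ * ((d7 + (lam - 2) / 2) ^ 2 + lam * (3 * lam - 4) / 4) := mul_nonneg hσ hq
    linarith
  have hS : 0 ≤ (lam * (M + N - σ) - (M + N) * (1 - d7)) + (lam - 1) * N - M * d7 := by
    by_contra h
    have : (lam - 1 + d7) * ((lam * (M + N - σ) - (M + N) * (1 - d7)) + (lam - 1) * N - M * d7) < 0 :=
      mul_neg_of_pos_of_neg hA (lt_of_not_ge h)
    linarith
  -- the identity for the composite row
  have e : lam * (ρ * M + N - ρ * σ) - (ρ * M + N) * (1 - ρ * d7) =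
      ρ ^ 2 * (lam * (M + N - σ) - (M + N) * (1 - d7)) + (1 - ρ) ^ 2 * ((lam - 1) * N) +
        ρ * (1 - ρ) * ((lam * (M + N - σ) - (M + N) * (1 - d7)) + (lam - 1) * N - M * d7) := by ring
  have t1 : 0 ≤ ρ ^ 2 * (lam * (M + N - σ) - (M + N) * (1 - d7)) := mul_nonneg (sq_nonneg _) hR
  have t2 : 0 ≤ (1 - ρ) ^ 2 * ((lam - 1) * N) := mul_nonneg (sq_nonneg _) (mul_nonneg (by linarith) (hσ.trans hσN))
  have t3 : 0 ≤ ρ * (1 - ρ) * ((lam * (M + N - σ) - (M + N) * (1 - d7)) + (lam - 1) * N - M * d7) :=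
    mul_nonneg (mul_nonneg hρ0 (by linarith)) hS
  linarith

/-- **Pair `cs`.**  In down-set coordinates `d = D(w[cs↦0])` (order relations + row `P3_λ`, `λ ≥ 4/3`), the vector
`(ρd0, ρd1, ρd2, ρd3, d4, d5, ρd6, ρd7)` of `w` (`ρ = 1 − w(cs)`) satisfies the row. [this work] -/
theorem dvec_p3lam_csPair {lam d0 d1 d2 d3 d4 d5 d6 d7 ρ : ℝ} (hlam : 4 / 3 ≤ lam)
    (hd : (0 : ℝ) ≤ d0 ∧ d0 ≤ d1 ∧ d0 ≤ d3 ∧ d0 ≤ d5 ∧ d0 ≤ d6 ∧ (0 : ℝ) ≤ d7 ∧ d7 ≤ 1 ∧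
      (0 : ℝ) ≤ d2 - d3 - d1 + d0 ∧ (0 : ℝ) ≤ d4 - d5 - d6 + d0 - d1 + d0)
    (hP : (d2 - d3 + d4 - d5 - d6 - d1 + 2 * d0) * (1 - d7) ≤ lam * (d2 - d3 + d4 - d5 - d6 - 2 * d1 + 3 * d0))
    (hρ0 : 0 ≤ ρ) (hρ1 : ρ ≤ 1) :
    (ρ * d2 - ρ * d3 + d4 - d5 - ρ * d6 - ρ * d1 + 2 * (ρ * d0)) * (1 - ρ * d7) ≤
      lam * (ρ * d2 - ρ * d3 + d4 - d5 - ρ * d6 - 2 * (ρ * d1) + 3 * (ρ * d0)) := by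
  obtain ⟨h0, h1, h3, h5, h6, h7, -, hζ, hτ⟩ := hd
  have key := pencil_row (M := d2 - d3 - d6 - d1 + 2 * d0) (N := d4 - d5) (σ := d1 - d0) (d7 := d7) hlam
    (by linarith) (by linarith) h7 hρ0 hρ1 (by convert hP using 2 <;> ring)
  convert key using 2 <;> ring

/-- **Pair `ca`** (the `s ↔ a` mirror of `dvec_p3lam_csPair`): the vector `(ρd0, ρd1, ρd2, ρd3, d4, ρd5, d6, ρd7)` satisfies the row. [this work] -/
theorem dvec_p3lam_caPair {lam d0 d1 d2 d3 d4 d5 d6 d7 ρ : ℝ} (hlam : 4 / 3 ≤ lam)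
    (hd : (0 : ℝ) ≤ d0 ∧ d0 ≤ d1 ∧ d0 ≤ d3 ∧ d0 ≤ d5 ∧ d0 ≤ d6 ∧ (0 : ℝ) ≤ d7 ∧ d7 ≤ 1 ∧
      (0 : ℝ) ≤ d2 - d3 - d1 + d0 ∧ (0 : ℝ) ≤ d4 - d5 - d6 + d0 - d1 + d0)
    (hP : (d2 - d3 + d4 - d5 - d6 - d1 + 2 * d0) * (1 - d7) ≤ lam * (d2 - d3 + d4 - d5 - d6 - 2 * d1 + 3 * d0))
    (hρ0 : 0 ≤ ρ) (hρ1 : ρ ≤ 1) :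
    (ρ * d2 - ρ * d3 + d4 - ρ * d5 - d6 - ρ * d1 + 2 * (ρ * d0)) * (1 - ρ * d7) ≤
      lam * (ρ * d2 - ρ * d3 + d4 - ρ * d5 - d6 - 2 * (ρ * d1) + 3 * (ρ * d0)) := by
  obtain ⟨h0, h1, h3, h5, h6, h7, -, hζ, hτ⟩ := hd
  have key := pencil_row (M := d2 - d3 - d5 - d1 + 2 * d0) (N := d4 - d6) (σ := d1 - d0) (d7 := d7) hlam
    (by linarith) (by linarith) h7 hρ0 hρ1 (by convert hP using 2 <;> ring)
  convert key using 2 <;> ring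

/-- **Pair `cb`**: the vector `(ρd0, ρd1, d2, d3, ρd4, ρd5, ρd6, ρd7)` satisfies the row (here `N = d2 − d3`, `M = τ = μ(F ∩ c∼S)`). [this work] -/
theorem dvec_p3lam_cbPair {lam d0 d1 d2 d3 d4 d5 d6 d7 ρ : ℝ} (hlam : 4 / 3 ≤ lam)
    (hd : (0 : ℝ) ≤ d0 ∧ d0 ≤ d1 ∧ d0 ≤ d3 ∧ d0 ≤ d5 ∧ d0 ≤ d6 ∧ (0 : ℝ) ≤ d7 ∧ d7 ≤ 1 ∧
      (0 : ℝ) ≤ d2 - d3 - d1 + d0 ∧ (0 : ℝ) ≤ d4 - d5 - d6 + d0 - d1 + d0)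
    (hP : (d2 - d3 + d4 - d5 - d6 - d1 + 2 * d0) * (1 - d7) ≤ lam * (d2 - d3 + d4 - d5 - d6 - 2 * d1 + 3 * d0))
    (hρ0 : 0 ≤ ρ) (hρ1 : ρ ≤ 1) :
    (d2 - d3 + ρ * d4 - ρ * d5 - ρ * d6 - ρ * d1 + 2 * (ρ * d0)) * (1 - ρ * d7) ≤
      lam * (d2 - d3 + ρ * d4 - ρ * d5 - ρ * d6 - 2 * (ρ * d1) + 3 * (ρ * d0)) := by
  obtain ⟨h0, h1, h3, h5, h6, h7, -, hζ, hτ⟩ := hd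
  have key := pencil_row (M := d4 - d5 - d6 - d1 + 2 * d0) (N := d2 - d3) (σ := d1 - d0) (d7 := d7) hlam
    (by linarith) (by linarith) h7 hρ0 hρ1 (by convert hP using 2 <;> ring)
  convert key using 2 <;> ring

/-! ## The pencil of a terminal pair across blocks -/

/-- **A terminal pair across blocks scales the down-set**: for `x, y ∈ T` with `blk x ≠ blk y`,
`P_{u[xy ↦ r]}(π|_T ≤ blk) = (1 − r)·P_{u[xy ↦ 0]}(π|_T ≤ blk)` (the down-set forces the pair to be closed).
[cite: BeicheltTittmann2012, §7.2, proof of Thm. 7.6 p. 169] -/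
theorem real_partLE_update_cross {κ : Type*} (u : Sym2 V → unitInterval) {T : Finset V} {blk : V → κ} {x y : V}
    (hx : x ∈ T) (hy : y ∈ T) (hbl : blk x ≠ blk y) (r : unitInterval) :
    (prodBernoulli (Function.update u s(x, y) r)).real (partLE T blk) =
      (1 - (r : ℝ)) * (prodBernoulli (Function.update u s(x, y) 0)).real (partLE T blk) := by
  have hempty : {ω : BondConfig V | insert s(x, y) ω ∈ partLE T blk} = ∅ := by
    refine eq_empty_of_forall_notMem fun ω hω => hbl ?_
    have hxy : insert s(x, y) ω ∈ openConn x y :=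
      (ThreePointIsoSexticEdgeNC.reachable_insert_iff x y).2
        (Or.inr (Or.inl ⟨SimpleGraph.Reachable.refl _, SimpleGraph.Reachable.refl _⟩))
    exact hω x hx y hy hxy
  rw [ThreePointIsoSexticEdgeNC.real_update_eq u s(x, y) r (partLE T blk), hempty, measureReal_empty]
  ring

/-! ## The three port–terminal pairs -/

section Pairs
variable {s a b c : V}

/-- **The pair `cs` is irrelevant to `P3_λ`, `λ ≥ 4/3`**: if the row holds for `w[cs ↦ 0]`, it holds for `w`. [this work] -/
theorem p3lam_of_csPair_zero {lam : ℝ} (hlam : 4 / 3 ≤ lam) (w : Sym2 V → unitInterval)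
    (hd : s ≠ a ∧ s ≠ b ∧ s ≠ c ∧ a ≠ b ∧ a ≠ c ∧ b ≠ c)
    (hrow : (prodBernoulli (Function.update w s(c, s) 0)).real (openConn s a ∩ (openConn s b)ᶜ : Set (BondConfig V)) *
        (prodBernoulli (Function.update w s(c, s) 0)).real ((openConn c s)ᶜ ∩ (openConn c a)ᶜ ∩ (openConn c b)ᶜ : Set (BondConfig V))ᶜ ≤
      lam * (prodBernoulli (Function.update w s(c, s) 0)).real
        (openConn s a ∩ (openConn s b)ᶜ ∩ ((openConn c s)ᶜ ∩ (openConn c a)ᶜ ∩ (openConn c b)ᶜ)ᶜ : Set (BondConfig V))) :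
    (prodBernoulli w).real (openConn s a ∩ (openConn s b)ᶜ : Set (BondConfig V)) *
        (prodBernoulli w).real ((openConn c s)ᶜ ∩ (openConn c a)ᶜ ∩ (openConn c b)ᶜ : Set (BondConfig V))ᶜ ≤
      lam * (prodBernoulli w).real (openConn s a ∩ (openConn s b)ᶜ ∩ ((openConn c s)ᶜ ∩ (openConn c a)ᶜ ∩ (openConn c b)ᶜ)ᶜ : Set (BondConfig V)) := by
  have hw : Function.update w s(c, s) (w s(c, s)) = w := Function.update_eq_self _ _
  have hc : c ∈ ({s, a, b, c} : Finset V) := by simp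
  have hs : s ∈ ({s, a, b, c} : Finset V) := by simp
  have G₀ := (rowLam_iff (Function.update w s(c, s) 0) lam s a b c).1 hrow
  have C₀ := core_of_weight (Function.update w s(c, s) 0) s a b c
  -- the eight coordinates along the pencil
  have X0 := real_partLE_update_cross w (blk := fun v => if v = a then 1 else if v = b then 2 else if v = c then 3 else (0 : ℕ))
    hc hs (by simp [hd.2.2.1, hd.2.2.2.2.1.symm, hd.2.2.2.2.2.symm, hd.1, hd.2.1]) (w s(c, s))
  have X1 := real_partLE_update_cross w (blk := fun v => if v = b then 1 else if v = c then 2 else (0 : ℕ))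
    hc hs (by simp [hd.2.2.2.2.2.symm, hd.2.1, hd.2.2.1]) (w s(c, s))
  have X2 := real_partLE_update_cross w (blk := fun v => if v = b ∨ v = c then 1 else (0 : ℕ))
    hc hs (by simp [hd.2.1, hd.2.2.1]) (w s(c, s))
  have X3 := real_partLE_update_cross w (blk := fun v => if v = a then 1 else if v = b ∨ v = c then 2 else (0 : ℕ))
    hc hs (by simp [hd.2.2.2.2.1.symm, hd.1, hd.2.1, hd.2.2.1]) (w s(c, s))
  have X4 := real_partLE_eq_update_zero w (blk := fun v => if v = b then 1 else (0 : ℕ)) hc hs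
    (by simp [hd.2.2.2.2.2.symm, hd.2.1])
  have X5 := real_partLE_eq_update_zero w (blk := fun v => if v = a then 1 else if v = b then 2 else (0 : ℕ)) hc hs
    (by simp [hd.2.2.2.2.1.symm, hd.2.2.2.2.2.symm, hd.1, hd.2.1])
  have X6 := real_partLE_update_cross w (blk := fun v => if v = a ∨ v = c then 1 else if v = b then 2 else (0 : ℕ))
    hc hs (by simp [hd.1, hd.2.1, hd.2.2.1]) (w s(c, s))
  have X7 := real_partLE_update_cross w (blk := fun v => if v = c then 1 else (0 : ℕ))
    hc hs (by simp [hd.2.2.1]) (w s(c, s))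
  rw [hw] at X0 X1 X2 X3 X6 X7
  rw [partLE_blk0 hd] at X0
  rw [partLE_blk1 hd] at X1
  rw [partLE_blk2 hd] at X2
  rw [partLE_blk3 hd] at X3
  rw [partLE_blk4 hd] at X4
  rw [partLE_blk5 hd] at X5
  rw [partLE_blk6 hd] at X6
  rw [partLE_blk7 hd] at X7
  refine (rowLam_iff w lam s a b c).2 ?_
  rw [X0, X1, X2, X3, X4, X5, X6, X7]
  exact dvec_p3lam_csPair hlam C₀ G₀ (sub_nonneg.2 (w s(c, s)).2.2) (by linarith [(w s(c, s)).2.1])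

/-- **The pair `ca` is irrelevant to `P3_λ`, `λ ≥ 4/3`**: if the row holds for `w[ca ↦ 0]`, it holds for `w`. [this work] -/
theorem p3lam_of_caPair_zero {lam : ℝ} (hlam : 4 / 3 ≤ lam) (w : Sym2 V → unitInterval)
    (hd : s ≠ a ∧ s ≠ b ∧ s ≠ c ∧ a ≠ b ∧ a ≠ c ∧ b ≠ c)
    (hrow : (prodBernoulli (Function.update w s(c, a) 0)).real (openConn s a ∩ (openConn s b)ᶜ : Set (BondConfig V)) *
        (prodBernoulli (Function.update w s(c, a) 0)).real ((openConn c s)ᶜ ∩ (openConn c a)ᶜ ∩ (openConn c b)ᶜ : Set (BondConfig V))ᶜ ≤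
      lam * (prodBernoulli (Function.update w s(c, a) 0)).real
        (openConn s a ∩ (openConn s b)ᶜ ∩ ((openConn c s)ᶜ ∩ (openConn c a)ᶜ ∩ (openConn c b)ᶜ)ᶜ : Set (BondConfig V))) :
    (prodBernoulli w).real (openConn s a ∩ (openConn s b)ᶜ : Set (BondConfig V)) *
        (prodBernoulli w).real ((openConn c s)ᶜ ∩ (openConn c a)ᶜ ∩ (openConn c b)ᶜ : Set (BondConfig V))ᶜ ≤
      lam * (prodBernoulli w).real (openConn s a ∩ (openConn s b)ᶜ ∩ ((openConn c s)ᶜ ∩ (openConn c a)ᶜ ∩ (openConn c b)ᶜ)ᶜ : Set (BondConfig V)) := by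
  have hw : Function.update w s(c, a) (w s(c, a)) = w := Function.update_eq_self _ _
  have hc : c ∈ ({s, a, b, c} : Finset V) := by simp
  have ha : a ∈ ({s, a, b, c} : Finset V) := by simp
  have G₀ := (rowLam_iff (Function.update w s(c, a) 0) lam s a b c).1 hrow
  have C₀ := core_of_weight (Function.update w s(c, a) 0) s a b c
  have X0 := real_partLE_update_cross w (blk := fun v => if v = a then 1 else if v = b then 2 else if v = c then 3 else (0 : ℕ))
    hc ha (by simp [hd.2.2.2.2.1.symm, hd.2.2.2.2.2.symm]) (w s(c, a))
  have X1 := real_partLE_update_cross w (blk := fun v => if v = b then 1 else if v = c then 2 else (0 : ℕ))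
    hc ha (by simp [hd.2.2.2.2.2.symm, hd.2.2.2.1, hd.2.2.2.2.1]) (w s(c, a))
  have X2 := real_partLE_update_cross w (blk := fun v => if v = b ∨ v = c then 1 else (0 : ℕ))
    hc ha (by simp [hd.2.2.2.1, hd.2.2.2.2.1]) (w s(c, a))
  have X3 := real_partLE_update_cross w (blk := fun v => if v = a then 1 else if v = b ∨ v = c then 2 else (0 : ℕ))
    hc ha (by simp [hd.2.2.2.2.1.symm]) (w s(c, a))
  have X4 := real_partLE_eq_update_zero w (blk := fun v => if v = b then 1 else (0 : ℕ)) hc ha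
    (by simp [hd.2.2.2.2.2.symm, hd.2.2.2.1])
  have X5 := real_partLE_update_cross w (blk := fun v => if v = a then 1 else if v = b then 2 else (0 : ℕ))
    hc ha (by simp [hd.2.2.2.2.1.symm, hd.2.2.2.2.2.symm]) (w s(c, a))
  have X6 := real_partLE_eq_update_zero w (blk := fun v => if v = a ∨ v = c then 1 else if v = b then 2 else (0 : ℕ)) hc ha
    (by simp)
  have X7 := real_partLE_update_cross w (blk := fun v => if v = c then 1 else (0 : ℕ))
    hc ha (by simp [hd.2.2.2.2.1]) (w s(c, a))
  rw [hw] at X0 X1 X2 X3 X5 X7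
  rw [partLE_blk0 hd] at X0
  rw [partLE_blk1 hd] at X1
  rw [partLE_blk2 hd] at X2
  rw [partLE_blk3 hd] at X3
  rw [partLE_blk4 hd] at X4
  rw [partLE_blk5 hd] at X5
  rw [partLE_blk6 hd] at X6
  rw [partLE_blk7 hd] at X7
  refine (rowLam_iff w lam s a b c).2 ?_
  rw [X0, X1, X2, X3, X4, X5, X6, X7]
  exact dvec_p3lam_caPair hlam C₀ G₀ (sub_nonneg.2 (w s(c, a)).2.2) (by linarith [(w s(c, a)).2.1])

/-- **The pair `cb` is irrelevant to `P3_λ`, `λ ≥ 4/3`**: if the row holds for `w[cb ↦ 0]`, it holds for `w`. [this work] -/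
theorem p3lam_of_cbPair_zero {lam : ℝ} (hlam : 4 / 3 ≤ lam) (w : Sym2 V → unitInterval)
    (hd : s ≠ a ∧ s ≠ b ∧ s ≠ c ∧ a ≠ b ∧ a ≠ c ∧ b ≠ c)
    (hrow : (prodBernoulli (Function.update w s(c, b) 0)).real (openConn s a ∩ (openConn s b)ᶜ : Set (BondConfig V)) *
        (prodBernoulli (Function.update w s(c, b) 0)).real ((openConn c s)ᶜ ∩ (openConn c a)ᶜ ∩ (openConn c b)ᶜ : Set (BondConfig V))ᶜ ≤
      lam * (prodBernoulli (Function.update w s(c, b) 0)).real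
        (openConn s a ∩ (openConn s b)ᶜ ∩ ((openConn c s)ᶜ ∩ (openConn c a)ᶜ ∩ (openConn c b)ᶜ)ᶜ : Set (BondConfig V))) :
    (prodBernoulli w).real (openConn s a ∩ (openConn s b)ᶜ : Set (BondConfig V)) *
        (prodBernoulli w).real ((openConn c s)ᶜ ∩ (openConn c a)ᶜ ∩ (openConn c b)ᶜ : Set (BondConfig V))ᶜ ≤
      lam * (prodBernoulli w).real (openConn s a ∩ (openConn s b)ᶜ ∩ ((openConn c s)ᶜ ∩ (openConn c a)ᶜ ∩ (openConn c b)ᶜ)ᶜ : Set (BondConfig V)) := by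
  have hw : Function.update w s(c, b) (w s(c, b)) = w := Function.update_eq_self _ _
  have hc : c ∈ ({s, a, b, c} : Finset V) := by simp
  have hb : b ∈ ({s, a, b, c} : Finset V) := by simp
  have G₀ := (rowLam_iff (Function.update w s(c, b) 0) lam s a b c).1 hrow
  have C₀ := core_of_weight (Function.update w s(c, b) 0) s a b c
  have X0 := real_partLE_update_cross w (blk := fun v => if v = a then 1 else if v = b then 2 else if v = c then 3 else (0 : ℕ))
    hc hb (by simp [hd.2.2.2.2.1.symm, hd.2.2.2.2.2.symm, hd.2.2.2.1.symm]) (w s(c, b))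
  have X1 := real_partLE_update_cross w (blk := fun v => if v = b then 1 else if v = c then 2 else (0 : ℕ))
    hc hb (by simp [hd.2.2.2.2.2.symm]) (w s(c, b))
  have X2 := real_partLE_eq_update_zero w (blk := fun v => if v = b ∨ v = c then 1 else (0 : ℕ)) hc hb (by simp)
  have X3 := real_partLE_eq_update_zero w (blk := fun v => if v = a then 1 else if v = b ∨ v = c then 2 else (0 : ℕ)) hc hb
    (by simp [hd.2.2.2.2.1.symm, hd.2.2.2.1.symm])
  have X4 := real_partLE_update_cross w (blk := fun v => if v = b then 1 else (0 : ℕ))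
    hc hb (by simp [hd.2.2.2.2.2.symm]) (w s(c, b))
  have X5 := real_partLE_update_cross w (blk := fun v => if v = a then 1 else if v = b then 2 else (0 : ℕ))
    hc hb (by simp [hd.2.2.2.2.1.symm, hd.2.2.2.2.2.symm, hd.2.2.2.1.symm]) (w s(c, b))
  have X6 := real_partLE_update_cross w (blk := fun v => if v = a ∨ v = c then 1 else if v = b then 2 else (0 : ℕ))
    hc hb (by simp [hd.2.2.2.1.symm, hd.2.2.2.2.2]) (w s(c, b))
  have X7 := real_partLE_update_cross w (blk := fun v => if v = c then 1 else (0 : ℕ))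
    hc hb (by simp [hd.2.2.2.2.2]) (w s(c, b))
  rw [hw] at X0 X1 X4 X5 X6 X7
  rw [partLE_blk0 hd] at X0
  rw [partLE_blk1 hd] at X1
  rw [partLE_blk2 hd] at X2
  rw [partLE_blk3 hd] at X3
  rw [partLE_blk4 hd] at X4
  rw [partLE_blk5 hd] at X5
  rw [partLE_blk6 hd] at X6
  rw [partLE_blk7 hd] at X7
  refine (rowLam_iff w lam s a b c).2 ?_
  rw [X0, X1, X2, X3, X4, X5, X6, X7]
  exact dvec_p3lam_cbPair hlam C₀ G₀ (sub_nonneg.2 (w s(c, b)).2.2) (by linarith [(w s(c, b)).2.1])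

end Pairs

end Summit.CriticalPhenomena.PercolationContinuityZ3.Theorems.SuperTerminalP3LamPortTermPairs
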